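import Summits.BirchSwinnertonDyer.Rank1Residual.Additive.CyclotomicGoodOrdinary
import Summits.BirchSwinnertonDyer.Rank1Residual.Additive.UnramifiedBaseChange
import HarnessLib

/-!
# Additive classes X3/X4: the ORDINARY refinement for `e ∈ {3, 4, 6}` — `SubGordHigher ⊆ TypeGOrd`, `ClassX3/4 ∧ SubGordHigher ⊆ ClassX3/4Gord`

HONEST FRAMING (cell `b2b-bsdres`, run/shared/lean/b2b/bsd-rank1-residual/, verbatim in every
file): the goal of the cell is to DELETE the COMBINATION-SHAPED residual classes of the
Birch–Swinnerton-Dyer formula for ALL analytic-rank `≤ 1` elliptic curves over `ℚ` — "full BSD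
formula for every rank `≤ 1` curve in class `C`" assembled STRICTLY from published theorems — so
that the rank-`≤ 1` remainder becomes exactly the CONSTRUCTION-SHAPED classes, which are TYPED
(missing-input `Prop`s), NOT attempted. This is not "finishing BSD". Sub-cell `additive-p2`
(X3/X4 at an additive prime, potentially good ORDINARY half): research route; no claim beyond the
stated classes; theorems only, no named fact; no label moves.

This file closes the last data-level entry of the sub-cell's theory/data dictionary
(AUDIT-X34-GORD.md §3): for the semistability defects `e ∈ {3, 4, 6}` (Kodaira `IV/IV*`,
`III/III*`, `II/II*`; 599 of the 946 X4♯(G-ord) and 33 of the 334 X3♯(G-ord) census pairs,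
N < 2·10⁴) additive-p4's DATA cell `SubGordHigher W p` (`SharpenedStatements.lean`:
`¬(ord_p j < 0)`, `f_p = 2`, `e ∣ p − 1`, `e ≠ 2`, `e = 12 / gcd(12, ord_p Δ_min)`) lies in the
THEORY class `TypeGOrd W p` of `PotGoodOrdinary.lean` (Delbourgo's (G) with ORDINARY reduction
above `p`) at every additive `p ≥ 5`; hence `ClassX3 ∧ SubGordHigher ⊆ ClassX3Gord` and
`ClassX4 ∧ SubGordHigher ⊆ ClassX4Gord`. Together with gen 0's `classX?Gord_of_goodOrd_quadraticTwist`
(`e = 2`, where the ordinary bit — `p ∤ a_p(E^{(p*)})` — is genuine data) the census sub-classes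
X3♯(G-ord)/X4♯(G-ord) map into the kernel classes entirely by kernel theorems.

Arithmetic of the data (`W` globally minimal, `v = ord_p Δ_min`, `e = 12/gcd(12, v)`, `ord_p j ≥ 0`):
* `3 ∣ v ⇒ e ∣ 4`, `2 ∣ v ⇒ e ∣ 6`, `e ∣ 12` (`semistabilityIndex_dvd_four_of_three_dvd`, …);
* `3 ∤ v ⇒ j = 0 ∨ ord_p j > 0` — `j = c₄³/Δ`, `ord_p j = 3 ord_p c₄ − v`
  (`j_eq_zero_or_padicValRat_j_pos_of_not_three_dvd`);
* `2 ∤ v ⇒ j = 1728 ∨ ord_p (j − 1728) > 0` (`p ≥ 5`) — `j − 1728 = c₆²/Δ`,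
  `ord_p (j − 1728) = 2 ord_p c₆ − v ≠ 0` and `≥ 0` since `ord_p 1728 = 0`
  (`j_eq_or_padicValRat_j_sub_pos_of_not_two_dvd`);
* `e = 1` (`12 ∣ v`) is impossible at an ADDITIVE `p ≥ 5`: `12 ∣ ord_p Δ` and `ord_p j ≥ 0` give good
  reduction over `ℚ` at `p` by the valuation criterion
  `hasGoodReductionAt_of_valuation_j_le_one_of_valuation_pow_twelve` (`CyclotomicGoodReduction.lean`,
  Silverman *AEC* VII.5.1), contradicting `Addv W p` (`hasAdditiveReductionAt_of_addv`)
  (`semistabilityIndex_ne_one_of_addv`);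
* so `e ∈ {3, 4, 6, 12}`; `3 ∣ e` gives the `j ≡ 0`, `3 ∣ p − 1` case and `4 ∣ e` the `j ≡ 1728`,
  `4 ∣ p − 1` case of `CyclotomicGoodOrdinary.lean` (with (G) itself from `typeG_of_subGord`):
  **`typeGOrd_of_addv_of_subGordHigher`**, **`classX3Gord_of_subGordHigher`**,
  **`classX4Gord_of_subGordHigher`**.

References: J.-P. Serre, J. Tate, Ann. of Math. 88 (1968) §2 Cor. 2; J. H. Silverman, *AEC*
VII.5.1, *ATAEC* IV §9 Table 4.1; D. Delbourgo, Compositio Math. 113 (1998) §1.2 Lemma (iv), §1.5;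
A. Kraus, Manuscripta Math. 69 (1990) (the types `II, III, IV, I₀*` at `p ≥ 5`).
-/

noncomputable section

open scoped Classical NumberField

open WeierstrassCurve IsDedekindDomain IsDedekindDomain.HeightOneSpectrum NumberField
  Literature.NumberTheory.EllipticCurves Literature.NumberTheory.EllipticCurves.Rank1Residual

namespace Summit.BirchSwinnertonDyer.Rank1Residual.Additive

/-! ### The data: `e ∈ {3, 6}` gives `j ≡ 0`, `e = 4` gives `j ≡ 1728` -/

section Data

variable (W : WeierstrassCurve ℚ) [W.IsElliptic] [W.IsGloballyMinimal] (p : ℕ) [hp : Fact p.Prime]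

omit [W.IsElliptic] hp in
/-- `e = 12 / gcd(12, v)`: if `3 ∣ v` then `e ∣ 4`, i.e. `e ∈ {1, 2, 4}`. -/
theorem semistabilityIndex_dvd_four_of_three_dvd
    (h : 3 ∣ padicValInt p W.minimalDiscriminantInt) : semistabilityIndex W p ∣ 4 := by
  set v := padicValInt p W.minimalDiscriminantInt with hv
  have h3 : 3 ∣ Nat.gcd 12 v := Nat.dvd_gcd (by norm_num) h
  obtain ⟨t, ht⟩ := h3
  have he : semistabilityIndex W p * Nat.gcd 12 v = 12 := by
    show 12 / Nat.gcd 12 v * Nat.gcd 12 v = 12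
    exact Nat.div_mul_cancel (Nat.gcd_dvd_left 12 v)
  rw [ht] at he
  exact Dvd.intro t (by linarith)

omit [W.IsElliptic] hp in
/-- `e = 12 / gcd(12, v)`: if `2 ∣ v` then `e ∣ 6`, i.e. `e ∈ {1, 2, 3, 6}`. -/
theorem semistabilityIndex_dvd_six_of_two_dvd
    (h : 2 ∣ padicValInt p W.minimalDiscriminantInt) : semistabilityIndex W p ∣ 6 := by
  set v := padicValInt p W.minimalDiscriminantInt with hv
  have h2 : 2 ∣ Nat.gcd 12 v := Nat.dvd_gcd (by norm_num) h
  obtain ⟨t, ht⟩ := h2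
  have he : semistabilityIndex W p * Nat.gcd 12 v = 12 := by
    show 12 / Nat.gcd 12 v * Nat.gcd 12 v = 12
    exact Nat.div_mul_cancel (Nat.gcd_dvd_left 12 v)
  rw [ht] at he
  exact Dvd.intro t (by linarith)

omit [W.IsElliptic] hp in
/-- The semistability index divides `12`. -/
theorem semistabilityIndex_dvd_twelve : semistabilityIndex W p ∣ 12 :=
  Nat.div_dvd_of_dvd (Nat.gcd_dvd_left 12 _)

omit [W.IsElliptic] hp in
/-- `ord_p Δ(W) = ord_p Δ_min` for the globally minimal model, as an integer. -/
theorem padicValRat_Δ_eq : padicValRat p W.Δ = (padicValInt p W.minimalDiscriminantInt : ℤ) := by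
  rw [← cast_minimalDiscriminantInt W, padicValRat.of_int]

/-- **`3 ∤ ord_p Δ_min` and `ord_p j ≥ 0` force `j ≡ 0 (mod p)`**: `j = c₄³/Δ`, so
`ord_p j = 3·ord_p c₄ − ord_p Δ` is divisible by `3` only if it is nonzero. -/
theorem j_eq_zero_or_padicValRat_j_pos_of_not_three_dvd (hj : 0 ≤ padicValRat p W.j)
    (h3 : ¬ 3 ∣ padicValInt p W.minimalDiscriminantInt) : W.j = 0 ∨ 0 < padicValRat p W.j := by
  by_cases hc4 : W.c₄ = 0
  · left; exact j_eq_zero _ hc4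
  right
  have hΔ0 : W.Δ ≠ 0 := W.isUnit_Δ.ne_zero
  have hjdef : W.j = W.c₄ ^ 3 / W.Δ := by
    rw [WeierstrassCurve.j, ← coe_Δ', div_eq_inv_mul, Units.val_inv_eq_inv_val]
  have hval : padicValRat p W.j = 3 * padicValRat p W.c₄ - padicValRat p W.Δ := by
    rw [hjdef, padicValRat.div (pow_ne_zero 3 hc4) hΔ0, padicValRat.pow]
    push_cast; ring
  rcases hj.lt_or_eq with h | h
  · exact h
  exfalso
  apply h3
  have h0 : 3 * padicValRat p W.c₄ - padicValRat p W.Δ = 0 := by rw [← hval, ← h]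
  rw [padicValRat_Δ_eq W p] at h0
  have : (3 : ℤ) ∣ (padicValInt p W.minimalDiscriminantInt : ℤ) := ⟨padicValRat p W.c₄, by linarith⟩
  exact_mod_cast this

/-- **`2 ∤ ord_p Δ_min` and `ord_p j ≥ 0` force `j ≡ 1728 (mod p)`** (`p ≥ 5`): `j − 1728 = c₆²/Δ`,
so `ord_p (j − 1728) = 2·ord_p c₆ − ord_p Δ` is odd, hence nonzero, and it is `≥ 0` because
`ord_p j ≥ 0 = ord_p 1728`. -/
theorem j_eq_or_padicValRat_j_sub_pos_of_not_two_dvd (hp5 : 5 ≤ p) (hj : 0 ≤ padicValRat p W.j)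
    (h2 : ¬ 2 ∣ padicValInt p W.minimalDiscriminantInt) :
    W.j = 1728 ∨ 0 < padicValRat p (W.j - 1728) := by
  by_cases hc6 : W.c₆ = 0
  · left; exact (SpecialJ.j_eq_iff_c₆_eq_zero W).mpr hc6
  right
  have hΔ0 : W.Δ ≠ 0 := W.isUnit_Δ.ne_zero
  have hsub : W.j - 1728 = W.c₆ ^ 2 / W.Δ := by
    have hjdef : W.j = W.c₄ ^ 3 / W.Δ := by
      rw [WeierstrassCurve.j, ← coe_Δ', div_eq_inv_mul, Units.val_inv_eq_inv_val]
    rw [hjdef, eq_div_iff hΔ0, sub_mul, div_mul_cancel₀ _ hΔ0]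
    linear_combination -W.c_relation
  have hne : W.j - 1728 ≠ 0 := by
    rw [hsub]; exact div_ne_zero (pow_ne_zero 2 hc6) hΔ0
  have hval : padicValRat p (W.j - 1728) = 2 * padicValRat p W.c₆ - padicValRat p W.Δ := by
    rw [hsub, padicValRat.div (pow_ne_zero 2 hc6) hΔ0, padicValRat.pow]
    push_cast; ring
  -- `ord_p (j − 1728) ≥ 0`
  have h1728 : padicValRat p (-1728 : ℚ) = 0 := by
    rw [padicValRat.neg, show (1728 : ℚ) = ((1728 : ℕ) : ℚ) by norm_num, padicValRat.of_nat]
    norm_cast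
    rw [padicValNat.eq_zero_of_not_dvd]
    intro h
    have h6 : p ∣ 2 ^ 6 * 3 ^ 3 := by norm_num at h ⊢; exact h
    rcases (Nat.Prime.dvd_mul hp.out).mp h6 with h' | h'
    · have := Nat.le_of_dvd (by norm_num) (Nat.Prime.dvd_of_dvd_pow hp.out h'); omega
    · have := Nat.le_of_dvd (by norm_num) (Nat.Prime.dvd_of_dvd_pow hp.out h'); omega
  have hnonneg : 0 ≤ padicValRat p (W.j - 1728) := by
    have hmin := padicValRat.min_le_padicValRat_add (p := p) (q := W.j) (r := -1728)
      (by rw [← sub_eq_add_neg]; exact hne)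
    rw [← sub_eq_add_neg, h1728] at hmin
    exact le_trans (le_min hj le_rfl) hmin
  rcases hnonneg.lt_or_eq with h | h
  · exact h
  exfalso
  apply h2
  have h0 : 2 * padicValRat p W.c₆ - padicValRat p W.Δ = 0 := by rw [← hval, ← h]
  rw [padicValRat_Δ_eq W p] at h0
  have : (2 : ℤ) ∣ (padicValInt p W.minimalDiscriminantInt : ℤ) := ⟨padicValRat p W.c₆, by linarith⟩
  exact_mod_cast this

omit [W.IsElliptic] [W.IsGloballyMinimal] hp in
/-- `Rat.padicValuation q x = exp(−ord_q x)` for `x ≠ 0` (unfolding Mathlib's definition). -/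
theorem padicValuation_apply_of_ne_zero (q : ℕ) [Fact q.Prime] {x : ℚ} (hx : x ≠ 0) :
    Rat.padicValuation q x = WithZero.exp (-padicValRat q x) := by
  simp [Rat.padicValuation, hx]

/-- **`e = 1` is impossible at an additive prime `p ≥ 5` with `ord_p j ≥ 0`**: `12 ∣ ord_p Δ_min`
and `ord_p j ≥ 0` give good reduction over `ℚ` at `p` (valuation criterion
`hasGoodReductionAt_of_valuation_j_le_one_of_valuation_pow_twelve`, Silverman *AEC* VII.5.1),
contradicting `Addv W p` (`hasAdditiveReductionAt_of_addv`). -/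
theorem semistabilityIndex_ne_one_of_addv (hp5 : 5 ≤ p) (hadd : Addv W p)
    (hj : 0 ≤ padicValRat p W.j) : semistabilityIndex W p ≠ 1 := by
  intro he
  -- `12 ∣ v`
  set v := padicValInt p W.minimalDiscriminantInt with hvdef
  have hg : Nat.gcd 12 v = 12 := by
    have h1 : 12 / Nat.gcd 12 v = 1 := he
    have := Nat.div_mul_cancel (Nat.gcd_dvd_left 12 v)
    rw [h1, one_mul] at this
    exact this
  have h12 : 12 ∣ v := by rw [← hg]; exact Nat.gcd_dvd_right 12 v
  obtain ⟨k, hk⟩ := h12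
  -- the place of `𝓞 ℚ` above `p`
  set u : HeightOneSpectrum (𝓞 ℚ) := (Rat.HeightOneSpectrum.primesEquiv (R := 𝓞 ℚ)).symm ⟨p, hp.out⟩
    with hudef
  have hadd' : W.HasAdditiveReductionAt u := hasAdditiveReductionAt_of_addv W p hadd
  apply hadd'.not_hasGoodReductionAt
  -- `2, 3 ∉ u`
  have hnotMem : ∀ q : ℕ, (hq : q.Prime) → q ≠ p → (q : 𝓞 ℚ) ∉ u.asIdeal := by
    intro q hq hqp hmem
    have h := (natCast_mem_asIdeal_iff_eq_primesEquiv_symm u hq).mp hmem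
    rw [hudef] at h
    exact hqp (congrArg Subtype.val
      ((Rat.HeightOneSpectrum.primesEquiv (R := 𝓞 ℚ)).symm.injective h)).symm
  have h2 : (2 : 𝓞 ℚ) ∉ u.asIdeal := by simpa using hnotMem 2 Nat.prime_two (by omega)
  have h3 : (3 : 𝓞 ℚ) ∉ u.asIdeal := by simpa using hnotMem 3 Nat.prime_three (by omega)
  -- valuations at `u` are `p`-adic
  haveI : Fact (Nat.Prime ((Rat.HeightOneSpectrum.primesEquiv u : Nat.Primes) : ℕ)) :=
    ⟨(Rat.HeightOneSpectrum.primesEquiv u).2⟩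
  have hequiv := Rat.HeightOneSpectrum.valuation_equiv_padicValuation u
  have hq : ((Rat.HeightOneSpectrum.primesEquiv u : Nat.Primes) : ℕ) = p := by
    rw [hudef, Equiv.apply_symm_apply]
  -- `u(j) ≤ 1`
  have hj1 : u.valuation ℚ W.j ≤ 1 := by
    rw [Valuation.isEquiv_iff_val_le_one.mp hequiv]
    by_cases hj0 : W.j = 0
    · rw [hj0, map_zero]; exact zero_le
    rw [padicValuation_apply_of_ne_zero _ hj0, ← WithZero.exp_zero, WithZero.exp_le_exp, hq]
    linarith
  -- `u(δ)¹² = u(Δ)` with `δ = p^k`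
  have hΔ0 : W.Δ ≠ 0 := W.isUnit_Δ.ne_zero
  have hp0 : (p : ℚ) ≠ 0 := by exact_mod_cast hp.out.ne_zero
  have hvΔ : padicValRat p W.Δ = 12 * k := by
    rw [padicValRat_Δ_eq W p, ← hvdef, hk]; push_cast; ring
  have hδ : u.valuation ℚ ((p : ℚ) ^ k) ^ 12 = u.valuation ℚ W.Δ := by
    rw [← map_pow, hequiv.eq_iff, ← pow_mul, padicValuation_apply_of_ne_zero _ (pow_ne_zero _ hp0),
      padicValuation_apply_of_ne_zero _ hΔ0, WithZero.exp_inj, hq, padicValRat.pow,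
      padicValRat.self hp.out.one_lt, hvΔ]
    push_cast; ring
  exact hasGoodReductionAt_of_valuation_j_le_one_of_valuation_pow_twelve W h2 h3 hj1 hδ

/-- **The ORDINARY refinement for `e ∈ {3, 4, 6}`** (`p ≥ 5`, `E` additive at `p`): additive-p4's
data cell `SubGordHigher W p` (`¬(ord_p j < 0)`, `f_p = 2`, `e ∣ p − 1`, `e ≠ 2`) implies
Delbourgo's (G) WITH ORDINARY reduction above `p`, `TypeGOrd W p`. Cases on `e ∣ 12`: `e = 1` is
excluded by additivity (`semistabilityIndex_ne_one_of_addv`); `3 ∣ e` (`e ∈ {3, 6, 12}`) gives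
`3 ∤ ord_p Δ_min`, `j ≡ 0`, `3 ∣ p − 1`; `e ∈ {4, 12}` gives `2 ∤ ord_p Δ_min`, `j ≡ 1728`,
`4 ∣ p − 1`; (G) itself is `typeG_of_subGord` (`CyclotomicGoodReduction.lean`). (`e = 12` cannot
occur — it would give `p ∣ 1728` — but needs no separate treatment.) -/
theorem typeGOrd_of_addv_of_subGordHigher (hp5 : 5 ≤ p) (hadd : Addv W p)
    (hS : SubGordHigher W p) : TypeGOrd W p := by
  obtain ⟨hSub, hne2⟩ := hS
  have hG : TypeG W p := typeG_of_subGord W p hp5 hSub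
  obtain ⟨hnot, -, hdvd⟩ := hSub
  have hj : 0 ≤ padicValRat p W.j := not_lt.mp hnot
  have hne1 := semistabilityIndex_ne_one_of_addv W p hp5 hadd hj
  have h12 := semistabilityIndex_dvd_twelve W p
  -- `e ∈ {3, 4, 6, 12}`
  have he : semistabilityIndex W p = 3 ∨ semistabilityIndex W p = 4 ∨ semistabilityIndex W p = 6 ∨
      semistabilityIndex W p = 12 := by
    have hle : semistabilityIndex W p ≤ 12 := Nat.le_of_dvd (by norm_num) h12
    interval_cases h : semistabilityIndex W p <;> omega
  by_cases h3e : 3 ∣ semistabilityIndex W p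
  · -- `j ≡ 0`, `3 ∣ p − 1`
    have h3v : ¬ 3 ∣ padicValInt p W.minimalDiscriminantInt := by
      intro h
      have : 3 ∣ 4 := dvd_trans h3e (semistabilityIndex_dvd_four_of_three_dvd W p h)
      omega
    exact typeGOrd_of_typeG_of_padicValRat_j W p hp5 (dvd_trans h3e hdvd) hG
      (j_eq_zero_or_padicValRat_j_pos_of_not_three_dvd W p hj h3v)
  · -- `e = 4` (`e = 12` has `3 ∣ e`): `j ≡ 1728`, `4 ∣ p − 1`
    have h4e : 4 ∣ semistabilityIndex W p := by
      rcases he with h | h | h | h <;> rw [h] at h3e ⊢ <;> omega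
    have h2v : ¬ 2 ∣ padicValInt p W.minimalDiscriminantInt := by
      intro h
      have : 4 ∣ 6 := dvd_trans h4e (semistabilityIndex_dvd_six_of_two_dvd W p h)
      omega
    exact typeGOrd_of_typeG_of_padicValRat_j_sub W p hp5 (dvd_trans h4e hdvd) hG
      (j_eq_or_padicValRat_j_sub_pos_of_not_two_dvd W p hp5 hj h2v)

/-- **X3 ∩ (G-ord census cell, `e ≠ 2`) ⊆ X3♯(G-ord)** (`p ≥ 5`): an Eisenstein additive prime in
additive-p4's data cell `SubGordHigher` is an X3♯(G-ord) pair of `PotGoodOrdinary.lean`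
(`ClassX3Gord = ClassX3 ∧ TypeGOrd`). With `classX3Gord_of_goodOrd_quadraticTwist` (e = 2) this
completes the kernel form of the sub-class dictionary. -/
theorem classX3Gord_of_subGordHigher (hp5 : 5 ≤ p) (hX : ClassX3 W p) (hS : SubGordHigher W p) :
    ClassX3Gord W p :=
  ⟨hX, typeGOrd_of_addv_of_subGordHigher W p hp5 hX.2 hS⟩

/-- **X4 ∩ (G-ord census cell, `e ≠ 2`) ⊆ X4♯(G-ord)** (`p ≥ 5`). -/
theorem classX4Gord_of_subGordHigher (hp5 : 5 ≤ p) (hX : ClassX4 W p) (hS : SubGordHigher W p) :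
    ClassX4Gord W p :=
  ⟨hX, typeGOrd_of_addv_of_subGordHigher W p hp5 hX.2.1 hS⟩

end Data

end Summit.BirchSwinnertonDyer.Rank1Residual.Additive

end
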